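import Summits.BirchSwinnertonDyer.BirchSwinnertonDyer.Theorems.SylvesterTwoHeegnerIndexUpperOffV0DescentDefect
import Summits.BirchSwinnertonDyer.BirchSwinnertonDyer.Theorems.SylvesterTwoHeegnerIndexUpperOffV0CebotarevTwoShear
import Literature.NumberTheory.EllipticCurves.HeegnerPointsKolyvaginPrimaryLeavesProofs
import HarnessLib

/-!
# K7t crux `UpperOffV0HSY` (item 19581): the 2-adic descent from the leaves — step (f₂)
# `2⁴ · 4^{M₀} · S_{2^M}(E/K) ⊆ ℤ δ_M x₀` for the CM curves `y² = x³ − c`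

Route `SylvesterTwoHeegnerIndex` (cell bsd-cm, rung K7t), line `offv0-kolyvagin2`.  The tree's
`KolyvaginDescent.exists_hypothesesM_of_leavesM` (`Literature/…/HeegnerPointsKolyvaginPrimaryLeavesProofs`)
assembles the data `HypothesesM` of Kolyvagin's descent modulo `p^M` on `H¹(K, E[p^M])` from the two
Euler-system leaves — (A) Kolyvagin's classes `c_M(n)` with McCallum (6), Lemma 4.3, Prop. 4.4,
Gross Props. 5.3/5.4 (2), and (B) Lemma 5.3 with Prop. 2.2 in descent form — for `p` ODD with
`ρ̄_{E,p}` onto.  This file is the `p = 2` twin for a `ℚ`-model `W` of `y² = x³ − c` over an imaginary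
quadratic `K` with `∛c ∉ K`, `ω ∉ K`: the SAME leaves at `p = 2` (the shapes of the registered stubs
(d) `stub_kolyvaginClasses_two` and, through `lemma_5_3_descent_of_reciprocity_two` (p467003),
(e) `stub_kolyvaginReciprocity_two`; (B) is taken here in descent form WITH DEFECT ONE,
`2^{M-1-a+1} s_λ = 0`), the hypothesis `E(K)[2] = 0` in place of the surjectivity of `ρ̄`, and the
Lemma-5.1 bookkeeping `P = 2^{M₀} x₀`, `δ_M P = 2^{M₀} δ_M x₀`, `2^{M-1} δ_M x₀ ≠ 0` — fed into the
parity-free count `DescentDefect.descent_defect'` (p462120), with its two Čebotarev inputs DISCHARGED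
by the tree: `cebotarev` := `exists_kolyvaginPrime_gt_twoPow_holds` (p449935) and `hceb₁` :=
`exists_kolyvaginPrime_gt_twoPow_socle` (p467040):

* `descentTwo_of_leaves` — **`(2 · 2^{2M₀+3}) · s ∈ ℤ δ_M x₀` for every `s ∈ S_{2^M}(E/K)`**, i.e.
  `2^{2M₀+4} S_{2^M}(E/K) ⊆ δ_M(E(K))`: the generic 2-adic Kolyvagin EXPONENT bound for these CM
  curves — step (f₂) of the honest re-cut of the XL stub `stub_upperOffV0_of_kolyvaginDescent_two`.

NOT the crux: the crux asks for the ORDER bound with constant `0` (B14 = O12, open as a class).  What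
this leaves for (f): producing the leaves (d), (e) at `2` (the koly2 seat) and the Lemma 5.1
bookkeeping from a Heegner point of infinite order (as in the tree's `…PrimaryAtPrimeProofs`).
-/

noncomputable section

open scoped Classical
open WeierstrassCurve NumberField IsDedekindDomain Field Literature.NumberTheory.EllipticCurves
  Literature.NumberTheory.GaloisRepresentations

set_option autoImplicit false
set_option linter.dupNamespace false

namespace Summit.BirchSwinnertonDyer.BirchSwinnertonDyer.Theorems.SylvesterTwoUpper

universe u

variable {N : ℕ} [NeZero N] {W : WeierstrassCurve ℚ} {K : Type u} [Field K] [NumberField K]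

set_option maxHeartbeats 800000 in
/-- **Kolyvagin's descent modulo `2^M` from the leaves, for `y² = x³ − c`: `2^{2M₀+4} S_{2^M}(E/K) ⊆
ℤ δ_M x₀`.**  Inputs as in the tree's `exists_hypothesesM_of_leavesM` with `p := 2` — `K` imaginary
quadratic with conjugation `c`, `E(K)[2] = 0` (`hA2`), `P = 2^{M₀} x₀` with `δ_M P = 2^{M₀} δ_M x₀`
and `2^{M-1} δ_M x₀ ≠ 0`, the sign `ε` of `P` (Gross Prop. 5.3), leaf (A) (`cl`, `hc1`, `hcl`:
McCallum (6), Lemma 4.3, Prop. 4.4, Gross Prop. 5.4 (2) at the Kolyvagin primes of level `M` at `2`)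
and leaf (B) in descent form with defect one (`hdual`: `2^a d_λ ≠ 0 ⟹ 2^{M-1-a+1} s_λ = 0`, which is
`lemma_5_3_descent_of_reciprocity_two` applied to (R)_M) — plus the model data `C • W = y² = x³ − c`,
`∛c ∉ K`, `ω ∉ K` for the two Čebotarev theorems at `2`.  Output: the conclusion of
`DescentDefect.descent_defect'` at `p = 2`, `δ = 1`. [cite: McCallumLMS1991, §1 Theorem (Kolyvagin), §§3–5]
[cite: GrossLMS1991, Thm. 1.3, §10] -/
theorem descentTwo_of_leaves [W.IsElliptic] (hK : IsImaginaryQuadratic K)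
    {C : VariableChange ℚ} {cM : ℚ} (hCW : C • W = ⟨0, 0, 0, 0, -cM⟩)
    (hcube : ∀ x : K, x ^ 3 ≠ (cM : K)) (hωK : ∀ x : K, x ^ 2 + x + 1 ≠ 0)
    {P : (W.baseChange K).toAffine.Point} {M : ℕ} (hM : 1 ≤ M)
    (hdiv : ∀ Q : geomPoints (W.baseChange K), ∃ R, ((2 ^ M : ℕ) : ℤ) • R = Q)
    {c : K ≃ₐ[ℚ] K} (hc : c ≠ 1) (hcc : c * c = 1)
    (hA2 : ∀ a : (W.baseChange K).toAffine.Point, 2 • a = 0 → a = 0)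
    {M₀ : ℕ} {x₀ : (W.baseChange K).toAffine.Point} (hx₀ : 2 ^ M₀ • x₀ = P)
    (hPx : kummerMapTorsion (W.baseChange K) _ hdiv P =
      (((2 : ℕ) : ℤ) ^ M₀) • kummerMapTorsion (W.baseChange K) _ hdiv x₀)
    (hxord : (((2 : ℕ) : ℤ) ^ (M - 1)) • kummerMapTorsion (W.baseChange K) _ hdiv x₀ ≠ 0)
    (ε : ℤ) (hε : ε = 1 ∨ ε = -1)
    (h53 : IsOfFinAddOrder (Affine.Point.map (W' := W) (c : K →ₐ[ℚ] K) P - ε • P))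
    (cl : ℕ → galH1Torsion (W.baseChange K) ((2 ^ M : ℕ) : ℤ))
    (hc1 : cl 1 = kummerMapTorsion (W.baseChange K) _ hdiv P)
    (hcl : ∀ m : ℕ, Squarefree m →
      (∀ q ∈ m.primeFactors, IsKolyvaginPrime N W K 2 q ∧ FrobEqFrobInfty W K (2 ^ M) q) →
      conjAct W c _ (cl m) = (ε * (-1) ^ m.primeFactors.card) • cl m ∧
      (∀ v : HeightOneSpectrum (𝓞 K), (m : 𝓞 K) ∉ v.asIdeal →
        cl m ∈ selmerLocalKer (W.baseChange K) (v.adicCompletion K) ((2 ^ M : ℕ) : ℤ)) ∧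
      (∀ ℓ : ℕ, ℓ.Prime → ℓ ∣ m → ∀ v : HeightOneSpectrum (𝓞 K), (ℓ : 𝓞 K) ∈ v.asIdeal →
        ∀ a : ℕ, ((((2 : ℕ) : ℤ) ^ a) • cl m ∈
            selmerLocalKer (W.baseChange K) (v.adicCompletion K) ((2 ^ M : ℕ) : ℤ) ↔
          (((2 : ℕ) : ℤ) ^ a) • cl (m / ℓ) ∈
            (W.baseChange K).torsionLocalKer (v.adicCompletion K) ((2 ^ M : ℕ) : ℤ))))
    (hdual : ∀ ℓ : ℕ, IsKolyvaginPrime N W K 2 ℓ ∧ FrobEqFrobInfty W K (2 ^ M) ℓ →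
      ∀ ν : ℤ, (ν = 1 ∨ ν = -1) → ∀ d : galH1Torsion (W.baseChange K) ((2 ^ M : ℕ) : ℤ),
      conjAct W c _ d = ν • d →
      (∀ v : HeightOneSpectrum (𝓞 K), (ℓ : 𝓞 K) ∉ v.asIdeal →
        d ∈ selmerLocalKer (W.baseChange K) (v.adicCompletion K) ((2 ^ M : ℕ) : ℤ)) →
      (∀ w : InfinitePlace K, d ∈ selmerLocalKer (W.baseChange K) w.Completion ((2 ^ M : ℕ) : ℤ)) →
      ∀ s ∈ selmerGroup (W.baseChange K) ((2 ^ M : ℕ) : ℤ), conjAct W c _ s = ν • s →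
      ∀ a : ℕ, a < M → ∀ v : HeightOneSpectrum (𝓞 K), (ℓ : 𝓞 K) ∈ v.asIdeal →
        (((2 : ℕ) : ℤ) ^ a) • d ∉
          selmerLocalKer (W.baseChange K) (v.adicCompletion K) ((2 ^ M : ℕ) : ℤ) →
        (((2 : ℕ) : ℤ) ^ (M - 1 - a + 1)) • s ∈
          (W.baseChange K).torsionLocalKer (v.adicCompletion K) ((2 ^ M : ℕ) : ℤ))
    {s : galH1Torsion (W.baseChange K) ((2 ^ M : ℕ) : ℤ)}
    (hs : s ∈ selmerGroup (W.baseChange K) ((2 ^ M : ℕ) : ℤ)) :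
    (2 * ((2 : ℕ) : ℤ) ^ (2 * M₀ + 2 * 1 + 1)) • s ∈
      AddSubgroup.zmultiples (kummerMapTorsion (W.baseChange K) _ hdiv x₀) := by
  -- `E(K)[2] = 0`
  have hA : ∀ a : (W.baseChange K).toAffine.Point, 2 • a = 0 → a = 0 := hA2
  -- `τ x = ε x`
  set x := kummerMapTorsion (W.baseChange K) _ hdiv x₀ with hxdef
  have hτx : conjAct W c _ x = ε • x := by
    rw [hxdef, conjAct_kummerMapTorsion W c _ hdiv x₀]
    set t := Affine.Point.map (W' := W) (c : K →ₐ[ℚ] K) x₀ - ε • x₀ with ht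
    have htP : 2 ^ M₀ • t = Affine.Point.map (W' := W) (c : K →ₐ[ℚ] K) P - ε • P := by
      rw [ht, smul_sub, ← map_nsmul, hx₀, smul_comm, hx₀]
    have htors : IsOfFinAddOrder t := by
      obtain ⟨k, hk, hkt⟩ := (isOfFinAddOrder_iff_nsmul_eq_zero).mp h53
      refine (isOfFinAddOrder_iff_nsmul_eq_zero).mpr
        ⟨k * 2 ^ M₀, Nat.mul_pos hk (pow_pos two_pos _), ?_⟩
      rw [mul_smul, htP, hkt]
    obtain ⟨s, hs⟩ := exists_pow_smul_eq_of_isOfFinAddOrder Nat.prime_two hA htors M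
    have hker : t ∈ (kummerMapTorsion (W.baseChange K) ((2 ^ M : ℕ) : ℤ) hdiv).ker := by
      rw [kummerMapTorsion_ker]
      exact ⟨s, by rw [← hs, Nat.cast_pow]; rfl⟩
    have ht0 : kummerMapTorsion (W.baseChange K) _ hdiv t = 0 := hker
    have : Affine.Point.map (W' := W) (c : K →ₐ[ℚ] K) x₀ = t + ε • x₀ := by rw [ht]; abel
    rw [this, map_add, ht0, zero_add, map_zsmul]
  -- the local conditions at the (complex) infinite places are empty
  have hinf : ∀ (w : InfinitePlace K) (y : galH1Torsion (W.baseChange K) ((2 ^ M : ℕ) : ℤ)),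
      y ∈ selmerLocalKer (W.baseChange K) w.Completion ((2 ^ M : ℕ) : ℤ) := fun w y ↦ by
    haveI : IsAlgClosed w.Completion :=
      isAlgClosed_of_ringEquiv (InfinitePlace.Completion.ringEquivComplexOfIsComplex
        (hK.2.isComplex w)).symm
    rw [WeierstrassCurve.selmerLocalKer_eq_top_of_isAlgClosed]
    trivial
  -- the parity-free count at `p = 2`, `δ = 1`
  refine DescentDefect.descent_defect' (p := 2) (M := M) (M₀ := M₀) (δ := 1)
    (Pl := HeightOneSpectrum (𝓞 K) ⊕ InfinitePlace K)
    (τ := conjAct W c _) (Sel := selmerGroup (W.baseChange K) _)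
    (Loc := Sum.elim (fun v ↦ selmerLocalKer (W.baseChange K) (v.adicCompletion K) _)
      (fun w ↦ selmerLocalKer (W.baseChange K) w.Completion _))
    (Kol := fun ℓ ↦ IsKolyvaginPrime N W K 2 ℓ ∧ FrobEqFrobInfty W K (2 ^ M) ℓ)
    (pl := fun ℓ ↦ if h : IsKolyvaginPrime N W K 2 ℓ ∧ FrobEqFrobInfty W K (2 ^ M) ℓ then
      Sum.inl h.1.place else Sum.inr (Classical.arbitrary _))
    (Dv := fun v n ↦ Sum.elim (fun v ↦ (n : 𝓞 K) ∈ v.asIdeal) (fun _ ↦ False) v)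
    (A := fun ℓ ↦ ⨅ (v : HeightOneSpectrum (𝓞 K)) (_ : (ℓ : 𝓞 K) ∈ v.asIdeal),
      (W.baseChange K).torsionLocalKer (v.adicCompletion K) _)
    (x := x) (ε := ε) (c := cl) Nat.prime_two ?_ ?_ ?_ ?_ ?_ ?_ ?_ ?_ hxord hε hτx ?_ ?_ ?_ ?_ ?_
    ?_ ?_ hs
  · -- torsion
    intro v
    have := zsmul_discreteH1_torsion ((2 ^ M : ℕ) : ℤ) v
    exact_mod_cast this
  · -- τ_τ
    exact conjAct_conjAct_of_mul_self W hcc _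
  · -- τ_mem
    exact fun s hs ↦ conjAct_mem_selmerGroup W hK.2.isComplex c _ hs
  · -- mem_sel_iff
    intro s
    rw [mem_selmerGroup_iff, Sum.forall]
    rfl
  · -- prime_of_kol
    exact fun ℓ h ↦ h.1.prime
  · -- dv_iff
    intro ℓ hℓ v
    rw [dif_pos hℓ]
    rcases v with v | w
    · simp only [Sum.elim_inl, Sum.inl.injEq]
      exact hℓ.1.mem_iff
    · simp
  · -- dv_mul
    intro ℓ ℓ' _ _ v
    rcases v with v | w
    · exact natCast_mul_mem_asIdeal
    · simp
  · -- x_mem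
    exact (mem_selmerGroup_iff _ _ _).mpr
      ⟨fun _ ↦ kummerMapTorsion_mem_selmerLocalKer _ _ _ _ x₀,
        fun _ ↦ kummerMapTorsion_mem_selmerLocalKer _ _ _ _ x₀⟩
  · -- c_one
    rw [hc1, hPx]
  · -- τ_c
    exact fun n hn ↦ (hcl n hn.1 hn.2).1
  · -- c_mem_loc
    intro n hn v hv
    rcases v with v | w
    · exact (hcl n hn.1 hn.2).2.1 v hv
    · exact hinf w (cl n)
  · -- c_mem_loc_iff
    intro ℓ m hℓ hn a
    rw [dif_pos hℓ]
    simp only [Sum.elim_inl, AddSubgroup.mem_iInf]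
    have key := (hcl (ℓ * m) hn.1 hn.2).2.2 ℓ hℓ.1.prime (dvd_mul_right ℓ m) hℓ.1.place
      hℓ.1.mem_place a
    rw [Nat.mul_div_cancel_left m hℓ.1.prime.pos] at key
    rw [key]
    constructor
    · intro h v hv
      rwa [hℓ.1.mem_iff.mp hv]
    · intro h
      exact h hℓ.1.place hℓ.1.mem_place
  · -- duality (defect one)
    intro ℓ hℓ ν hν d hd hoff s hs hτs a ha hat
    rw [dif_pos hℓ] at hoff hat
    simp only [AddSubgroup.mem_iInf]
    intro v hv
    refine hdual ℓ hℓ ν hν d hd (fun v' hv' ↦ ?_) (fun w ↦ ?_) s hs hτs a ha v hv ?_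
    · exact hoff (Sum.inl v') (fun h ↦ hv' (hℓ.1.mem_iff.mpr (Sum.inl_injective h)))
    · exact hoff (Sum.inr w) (by simp)
    · rwa [hℓ.1.mem_iff.mp hv]
  · -- cebotarev := Cor. 3.2 at `2` (independent eigen-families), Čebotarev a tree theorem
    intro r cs Nv h0 hN hτ hind b
    choose ex hex1 hexM hex hexmin hord using fun i ↦
      exists_addOrderOf_eq_pow (W.baseChange K) Nat.prime_two M (hx := h0 i)
    have hind' : ∀ a : Fin r → ℤ, ∑ i, a i • cs i = 0 → ∀ i, ((2 : ℤ) ^ ex i) ∣ a i := by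
      intro a ha i
      have h := (addOrderOf_dvd_iff_zsmul_eq_zero).mpr (hind a ha i)
      rw [hord i, Nat.cast_pow] at h
      exact_mod_cast h
    have hNe : ∀ i, Nv i ≤ ex i := fun i ↦ by
      by_contra hlt
      have hlt := Nat.lt_of_not_le hlt
      have hk : (((2 : ℕ) : ℤ) ^ (Nv i - 1)) • cs i = 0 := by
        have : Nv i - 1 = (Nv i - 1 - ex i) + ex i := by omega
        rw [this, pow_add, mul_smul, hex i]
        exact zsmul_zero _
      exact hN i (by omega) hk
    have hNM : ∀ i, Nv i ≤ M := fun i ↦ (hNe i).trans (hexM i)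
    obtain ⟨ℓ, hbℓ, hℓ, hℓN, hℓD, hℓp, hprime, hfrob, hloc⟩ :=
      exists_kolyvaginPrime_gt_twoPow_holds (N := N) W hCW hK hcube hωK hM hc cs hτ ex
        (fun i ↦ by exact_mod_cast hex i) hind' Nv hNe hNM b
    refine ⟨ℓ, hbℓ, ⟨⟨hℓ, hℓN, hℓD, hℓp, hprime, hfrob.of_dvd (dvd_pow_self 2 (by omega))⟩, hfrob⟩,
      fun i ↦ ⟨?_, fun hNi h ↦ ?_⟩⟩
    · simp only [AddSubgroup.mem_iInf]
      intro v hv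
      exact_mod_cast (hloc i v hv).1
    · simp only [AddSubgroup.mem_iInf] at h
      have hK₀ : IsKolyvaginPrime N W K 2 ℓ :=
        ⟨hℓ, hℓN, hℓD, hℓp, hprime, hfrob.of_dvd (dvd_pow_self 2 (by omega))⟩
      exact (hloc i hK₀.place hK₀.mem_place).2 hNi
        (by exact_mod_cast h hK₀.place hK₀.mem_place)
  · -- hceb₁ := Cor. 3.2 at `2` with a shear (the socle configuration)
    intro s d Ns k u b hτs hind hNs0 hNs hNs1 hτd hk2 hk hu hrel
    obtain ⟨ℓ, hbℓ, hℓ, hℓN, hℓD, hℓp, hprime, hfrob, hloc⟩ :=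
      exists_kolyvaginPrime_gt_twoPow_socle (N := N) W hCW hK hcube hωK hM hc hε hτx hτs hτd
        (by exact_mod_cast hxord) hind hNs0 (by exact_mod_cast hNs) (by exact_mod_cast hNs1) hk2
        (by exact_mod_cast hk) (by exact_mod_cast hu) (by exact_mod_cast hrel) b
    have hK₀ : IsKolyvaginPrime N W K 2 ℓ :=
      ⟨hℓ, hℓN, hℓD, hℓp, hprime, hfrob.of_dvd (dvd_pow_self 2 (by omega))⟩
    refine ⟨ℓ, hbℓ, ⟨hK₀, hfrob⟩, ?_, fun h ↦ ?_, fun h ↦ ?_⟩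
    · simp only [AddSubgroup.mem_iInf]
      intro v hv
      exact (hloc v hv).1
    · simp only [AddSubgroup.mem_iInf] at h
      exact (hloc hK₀.place hK₀.mem_place).2.1 (by exact_mod_cast h hK₀.place hK₀.mem_place)
    · simp only [AddSubgroup.mem_iInf] at h
      exact (hloc hK₀.place hK₀.mem_place).2.2 (by exact_mod_cast h hK₀.place hK₀.mem_place)

end Summit.BirchSwinnertonDyer.BirchSwinnertonDyer.Theorems.SylvesterTwoUpper

end
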